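import Literature.NumberTheory.LFunctions.ClassGroupExplicitFormulaBounds
import HarnessLib

/-!
# The smoothed character sum `Re Σ_n Λ_χ(n) g(log n)`: real zeros dropped by sign

Topic `Summits/QuantumAdvantage/QuantumAdvantage/Theorems`, helper for the stub
`stub_perCharacterDeficit_of_density` (line `subgroup-orthogonality-escape`, crux
`DegreeOnePrimesEscape`, stmt-QuantumAdvantage-11543).

For a number field `K`, a class group character `χ ≠ 1` and the Thorner–Zaman weight
`g = tzTest (log x) ε` (`0 < ε < (log x)/2`) with Laplace transform `F`, the exact explicit formula
`coefFordK_eq_explicit` at `s = 0` reads `Σ_n Λ_χ(n) g(log n) = −Σ_ρ m(ρ)F(−ρ) − m₀F(0) + J_χ(0)`.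
A REAL non-trivial zero `β` contributes `−m(β)F(−β)` with `F(−β) = ∫ g(u)e^{βu} du ≥ 0`, a
NON-POSITIVE real number. Hence, for an UPPER bound of the real part, all real zeros can be
dropped (`re_coefFordK_tzTest_le`):

  `Re Σ_n Λ_χ(n) g(log n) ≤ B + m₀ (log x + ε) + ‖J_χ(0)‖`

whenever `B` bounds every finite partial sum `Σ_{ρ ∈ u, Im ρ ≠ 0} m(ρ)‖F(−ρ)‖` over NON-REAL
zeros. No Landau–Page, Siegel or Deuring–Heilbronn input is involved.
-/

noncomputable section

open Complex Real MeasureTheory Set Filter Topology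
open scoped NumberField nonZeroDivisors
open Literature.NumberTheory.LFunctions Literature.NumberTheory.LFunctions.NumberField
  Literature.NumberTheory.LFunctions.EntireEF Literature.NumberTheory.LFunctions.TZWeight

namespace Summit.QuantumAdvantage.QuantumAdvantage.Theorems.DegreeOnePrimesEscape

variable {K : Type} [Field K] [NumberField K]

/-- **At a real point the zero term is non-negative**: `Re (m · F(−ρ)) ≥ 0` for `Im ρ = 0`, since
`F(−β) = ∫₀^{L+ε} g(u) e^{βu} du` with `g ≥ 0`. -/
theorem re_zeroTerm_nonneg_of_im_eq_zero {L ε : ℝ} (hL : 0 < L) (hε : 0 < ε) (m : ℕ) {ρ : ℂ}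
    (hρ : ρ.im = 0) : 0 ≤ ((m : ℂ) * fordLaplace (tzTest L ε) (-ρ)).re := by
  have hρ' : ρ = ((ρ.re : ℝ) : ℂ) := by
    apply Complex.ext <;> simp [hρ]
  rw [hρ', fordLaplace_tzTest_ofReal hL hε ρ.re, ← Complex.ofReal_natCast, ← Complex.ofReal_mul,
    Complex.ofReal_re]
  refine mul_nonneg (Nat.cast_nonneg _) ?_
  refine intervalIntegral.integral_nonneg (by linarith) fun u _ ↦ ?_
  exact mul_nonneg (tzTest_mem_Icc L ε u).1 (Real.exp_pos _).le

/-- **Real zeros dropped by sign.** For `χ ≠ 1`, `x > 1`, `0 < ε < (log x)/2` and any `B` bounding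
the finite partial sums `Σ_{ρ ∈ u, Im ρ ≠ 0} m(ρ) ‖F(−ρ)‖` over the NON-REAL non-trivial zeros of
`L₀(·,χ)` (`F` the Laplace transform of `g = tzTest (log x) ε`):
`Re K_{g,Λ_χ}(0) = Re Σ_n Λ_χ(n) g(log n) ≤ B + m₀ (log x + ε) + ‖J_χ(0)‖`,
`m₀ = ord₀ L₀(·,χ)`, `J_χ` the left-line integral `cgEFRemainder`. -/
theorem re_coefFordK_tzTest_le {χ : ClassGroup (𝓞 K) →* ℂˣ} (hχ : χ ≠ 1) {x ε : ℝ} (hx : 1 < x)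
    (hε : 0 < ε) (hεL : ε < Real.log x / 2) {B : ℝ}
    (hB : ∀ u : Finset ℂ, (∀ ρ ∈ u, classGroupLFunction₀ K χ ρ = 0 ∧ 0 < ρ.re ∧ ρ.re < 1) →
      ∑ ρ ∈ u with ρ.im ≠ 0, (analyticOrderNatAt (classGroupLFunction₀ K χ) ρ : ℝ) *
        ‖fordLaplace (tzTest (Real.log x) ε) (-ρ)‖ ≤ B) :
    (coefFordK (cgCoef χ) (tzTest (Real.log x) ε) 0).re ≤
      B + (analyticOrderNatAt (classGroupLFunction₀ K χ) 0 : ℝ) * (Real.log x + ε) +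
        ‖cgEFRemainder χ (tzTest (Real.log x) ε) 0‖ := by
  classical
  set Lx := Real.log x with hLx
  have hL : 0 < Lx := Real.log_pos hx
  set g := tzTest Lx ε with hg
  have hadm := isSmoothedEFTest_tzTest hL hε
  have hg0 : g 0 = 0 := tzTest_zero hL hε hεL.le
  set L0 := classGroupLFunction₀ K χ with hL0
  have hsz : ∀ ρ : ℂ, L0 ρ = 0 → 0 < ρ.re → ρ.re < 1 → ρ ≠ 0 := by
    intro ρ _ h1 _ h; rw [h] at h1; simp at h1
  have hexpl := coefFordK_eq_explicit hχ hadm hg0 (s := 0) (by norm_num) (by norm_num) hsz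
  -- the zero sum and its non-real majorant
  set a : nontrivialZeros L0 → ℂ := fun ρ ↦
    (analyticOrderNatAt L0 (ρ : ℂ) : ℂ) * fordLaplace₀ g (0 - ρ) with ha
  have hsum : Summable (fun ρ ↦ ‖a ρ‖) :=
    summable_norm_cgZeroTerm hχ hadm (s := 0) (by norm_num) hsz
  have hsum' : Summable a := hsum.of_norm
  set b : nontrivialZeros L0 → ℝ := fun ρ ↦ if (ρ : ℂ).im = 0 then 0 else ‖a ρ‖ with hb
  have hab : ∀ ρ, -(a ρ).re ≤ b ρ := by
    intro ρ
    by_cases him : (ρ : ℂ).im = 0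
    · rw [hb]; dsimp only; rw [if_pos him, ha]; dsimp only
      rw [zero_sub, fordLaplace₀_eq_fordLaplace hg0]
      have := re_zeroTerm_nonneg_of_im_eq_zero hL hε (analyticOrderNatAt L0 ρ) him
      linarith
    · rw [hb]; dsimp only; rw [if_neg him]
      exact (neg_le_abs _).trans (Complex.abs_re_le_norm _)
  have hb0 : ∀ ρ, 0 ≤ b ρ := fun ρ ↦ by rw [hb]; dsimp only; split_ifs <;> positivity
  have hble : ∀ ρ, b ρ ≤ ‖a ρ‖ := fun ρ ↦ by
    rw [hb]; dsimp only; split_ifs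
    · exact norm_nonneg _
    · exact le_rfl
  have hbsum : Summable b := Summable.of_nonneg_of_le hb0 hble hsum
  -- partial sums of `b` are `≤ B`
  have hbB : ∑' ρ, b ρ ≤ B := by
    refine hbsum.tsum_le_of_sum_le fun s ↦ ?_
    have hinj : Set.InjOn (Subtype.val : nontrivialZeros L0 → ℂ) ↑s := fun a _ b _ h ↦ Subtype.ext h
    have hBs := hB (s.image Subtype.val) (fun ρ hρ ↦ ?_)
    · refine le_trans (le_of_eq ?_) hBs
      rw [Finset.sum_filter, Finset.sum_image hinj]
      refine Finset.sum_congr rfl fun ρ _ ↦ ?_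
      rw [hb]; dsimp only
      by_cases him : (ρ : ℂ).im = 0
      · rw [if_pos him, if_neg (not_not.2 him)]
      · rw [if_neg him, if_pos him, ha]; dsimp only
        rw [zero_sub, fordLaplace₀_eq_fordLaplace hg0, norm_mul, Complex.norm_natCast]
    · obtain ⟨ρ', _, rfl⟩ := Finset.mem_image.1 hρ
      exact ρ'.2
  -- the real part of the zero sum
  have hre : (∑' ρ, a ρ).re = ∑' ρ, (a ρ).re := Complex.re_tsum hsum'
  have hresum : Summable fun ρ ↦ (a ρ).re := (Complex.hasSum_re hsum'.hasSum).summable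
  have hnegS : -(∑' ρ, a ρ).re ≤ B := by
    rw [hre, ← tsum_neg]
    exact (hresum.neg.tsum_le_tsum hab hbsum).trans hbB
  -- `m₀ F(0)` and `J`
  have hF0 : ‖fordLaplace₀ g 0‖ ≤ Lx + ε := by
    rw [fordLaplace₀_eq_fordLaplace hg0]; exact norm_fordLaplace_tzTest_zero_le hL hε hεL
  have h2 : -((analyticOrderNatAt L0 0 : ℂ) * fordLaplace₀ g 0).re ≤
      (analyticOrderNatAt L0 0 : ℝ) * (Lx + ε) := by
    calc -((analyticOrderNatAt L0 0 : ℂ) * fordLaplace₀ g 0).re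
        ≤ ‖(analyticOrderNatAt L0 0 : ℂ) * fordLaplace₀ g 0‖ :=
          (neg_le_abs _).trans (Complex.abs_re_le_norm _)
      _ = (analyticOrderNatAt L0 0 : ℝ) * ‖fordLaplace₀ g 0‖ := by
          rw [norm_mul, Complex.norm_natCast]
      _ ≤ _ := mul_le_mul_of_nonneg_left hF0 (Nat.cast_nonneg _)
  have h3 : (cgEFRemainder χ g 0).re ≤ ‖cgEFRemainder χ g 0‖ := Complex.re_le_norm _
  rw [hexpl]
  simp only [Complex.sub_re, Complex.neg_re, Complex.add_re]
  linarith

/-- Closed form of `re_coefFordK_tzTest_le`: the registered sub-goal of the stub `stub_perCharacterDeficit_of_density`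
proved by this file. -/
theorem perCharacterDeficit_smoothed : ∀ {K : Type} [Field K] [NumberField K] {χ : ClassGroup (𝓞 K) →* ℂˣ} (hχ : χ ≠ 1) {x ε : ℝ} (hx : 1 < x)
    (hε : 0 < ε) (hεL : ε < Real.log x / 2) {B : ℝ}
    (hB : ∀ u : Finset ℂ, (∀ ρ ∈ u, classGroupLFunction₀ K χ ρ = 0 ∧ 0 < ρ.re ∧ ρ.re < 1) →
      ∑ ρ ∈ u with ρ.im ≠ 0, (analyticOrderNatAt (classGroupLFunction₀ K χ) ρ : ℝ) *
        ‖fordLaplace (tzTest (Real.log x) ε) (-ρ)‖ ≤ B),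
    (coefFordK (cgCoef χ) (tzTest (Real.log x) ε) 0).re ≤
      B + (analyticOrderNatAt (classGroupLFunction₀ K χ) 0 : ℝ) * (Real.log x + ε) +
        ‖cgEFRemainder χ (tzTest (Real.log x) ε) 0‖ :=
  @re_coefFordK_tzTest_le

end Summit.QuantumAdvantage.QuantumAdvantage.Theorems.DegreeOnePrimesEscape

end
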